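import Literature.Algebra.Homology.HomotopyCategoryLefschetzNumber
import Literature.Algebra.Homology.TraceHomologySequence
import HarnessLib

/-!
# The Lefschetz number is additive on distinguished triangles of `K(Vect_K)` (LEAF B)

Layer `Literature/Algebra/Homology` (pure linear algebra over Mathlib; proved theorems only, 0 definitions, 0 named facts, no instances,
no notation). Row `EulerCharacteristicTriangle` proved `χ_H(T₂) = χ_H(T₁) + χ_H(T₃)` on a distinguished triangle `T` of Mathlib's
`HomotopyCategory (ModuleCat K) (ComplexShape.up ℤ)`; this file is its TRACE twin (Görtz–Wedhorn II Rem. 23.62 (2) for the additive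
invariant "trace of an endomorphism"): for `T ∈ distTriang` and an ENDOMORPHISM OF THE TRIANGLE `e : T ⟶ T` (three commuting squares),
with `T.obj₁.as`, `T.obj₃.as` having finite-dimensional, finitely supported cohomology,

  **`lefschetzNumber_hom₂_eq_add_of_distinguished : Λ_K(e.hom₂) = Λ_K(e.hom₁) + Λ_K(e.hom₃)`**

(`Λ_K` = row `HomotopyCategoryLefschetzNumber`). The long exact sequence of the homological functor `H⁰` (Mathlib `Functor.homologySequence_exact₁/₂/₃`,
`homologySequenceδ_naturality`) carries the endomorphism `(Hⁿ(e₁), Hⁿ(e₂), Hⁿ(e₃))`; each term splits its trace over the images of the two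
adjacent maps (row `TraceHomologySequence`'s `trace_τ₂_eq_of_exact`, BY NAME ×3) and the connecting-map traces cancel in pairs `n ↔ n+1` (row
`HopfTraceFormula`'s pairing lemma, BY NAME). A triangle endomorphism need not lift to a chain-level endomorphism of a degreewise split
sequence, so rows `LefschetzNumber(Homology)ShortExact` do not apply and are not restated. Library only (cell `pub-hodge-ring2`, count-neutral).

## References

* U. Görtz, T. Wedhorn, *Algebraic Geometry II* (2023), Remark 23.62 (2) (additivity on distinguished triangles). [GortzWedhorn2023]
* A. Hatcher, *Algebraic Topology* (2002), §2.C (Lefschetz numbers, proof of Thm. 2C.3). [HatcherAT2002]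
-/

open CategoryTheory CategoryTheory.Limits CategoryTheory.Pretriangulated

universe v u

namespace Literature.Algebra.Homology.Lefschetz

variable {K : Type u} [Field K]

/-- In an exact `X₁ → X₂ → X₃` of vector spaces with `X₁ = 0 = X₃`, also `X₂ = 0`. [cite: HatcherAT2002, §2.C] -/
theorem subsingleton_X₂_of_exact {S : ShortComplex (ModuleCat.{v} K)} (hS : S.Exact) [Subsingleton S.X₁] [Subsingleton S.X₃] :
    Subsingleton S.X₂ := by
  have hx : ∀ z : S.X₂, z = 0 := fun z => by
    have hz : z ∈ LinearMap.ker S.g.hom := Subsingleton.elim _ _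
    rw [← hS.moduleCat_range_eq_ker] at hz
    obtain ⟨w, rfl⟩ := hz
    rw [Subsingleton.elim w 0, map_zero]
  exact ⟨fun x y => by rw [hx x, hx y]⟩

/-- An endomorphism of the zero space has trace `0`. [cite: HatcherAT2002, §2.C] -/
theorem trace_eq_zero_of_subsingleton {M : Type*} [AddCommGroup M] [Module K M] [Subsingleton M] (g : M →ₗ[K] M) :
    LinearMap.trace K M g = 0 := by
  rw [Subsingleton.elim g 0, map_zero]

variable (T : Triangle (HomotopyCategory (ModuleCat.{v} K) (ComplexShape.up ℤ)))

/-- **The Lefschetz number is additive on distinguished triangles of `K(Vect_K)`**: for `T ∈ distTriang` and an endomorphism `e : T ⟶ T`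
of the triangle, `Λ_K(e.hom₂) = Λ_K(e.hom₁) + Λ_K(e.hom₃)`, as soon as `T.obj₁.as`, `T.obj₃.as` have finite-dimensional cohomology in finitely
many degrees. [cite: GortzWedhorn2023, Remark 23.62 (2)] [cite: HatcherAT2002, §2.C] -/
theorem lefschetzNumber_hom₂_eq_add_of_distinguished (hT : T ∈ distTriang _) (e : T ⟶ T) [∀ n, Module.Finite K (T.obj₁.as.homology n)]
    [∀ n, Module.Finite K (T.obj₃.as.homology n)] (h₁ : (GradedObject.finrankSupport fun n => T.obj₁.as.homology n).Finite)
    (h₃ : (GradedObject.finrankSupport fun n => T.obj₃.as.homology n).Finite) :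
    HomotopyCategory.lefschetzNumber e.hom₂ = HomotopyCategory.lefschetzNumber e.hom₁ + HomotopyCategory.lefschetzNumber e.hom₃ := by
  classical
  set F := HomotopyCategory.homologyFunctor (ModuleCat.{v} K) (ComplexShape.up ℤ) 0
  have hf₁ : ∀ n : ℤ, Module.Finite K ((F.shift n).obj T.obj₁) := fun n => moduleFinite_homologyFunctor_obj T.obj₁ n
  have hf₃ : ∀ n : ℤ, Module.Finite K ((F.shift n).obj T.obj₃) := fun n => moduleFinite_homologyFunctor_obj T.obj₃ n
  have hz : ∀ (X : HomotopyCategory (ModuleCat.{v} K) (ComplexShape.up ℤ)) (n : ℤ) [Module.Finite K (X.as.homology n)],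
      Module.finrank K (X.as.homology n) = 0 → Subsingleton ((F.shift n).obj X) := fun X n _ h0 => by
    haveI : Module.Finite K ((F.shift n).obj X) := moduleFinite_homologyFunctor_obj X n
    have h' : Module.finrank K ((F.shift n).obj X) = 0 := (finrank_homologyFunctor_obj X n).trans h0
    exact Module.finrank_zero_iff.1 h'
  -- the three exact pieces of the long exact sequence, with their endomorphisms
  let S₂ : ℤ → ShortComplex (ModuleCat.{v} K) := fun n => ShortComplex.mk _ _ (F.homologySequence_comp T hT n)
  let ψ₂ : ∀ n, S₂ n ⟶ S₂ n := fun n => ShortComplex.homMk ((F.shift n).map e.hom₁) ((F.shift n).map e.hom₂) ((F.shift n).map e.hom₃)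
    (by simp only [S₂, ← Functor.map_comp, e.comm₁]) (by simp only [S₂, ← Functor.map_comp, e.comm₂])
  let S₃ : ∀ n₀ n₁ : ℤ, n₀ + 1 = n₁ → ShortComplex (ModuleCat.{v} K) := fun n₀ n₁ h =>
    ShortComplex.mk _ _ (F.comp_homologySequenceδ T hT n₀ n₁ h)
  let ψ₃ : ∀ n₀ n₁ h, S₃ n₀ n₁ h ⟶ S₃ n₀ n₁ h := fun n₀ n₁ h => ShortComplex.homMk ((F.shift n₀).map e.hom₂) ((F.shift n₀).map e.hom₃)
    ((F.shift n₁).map e.hom₁) (by simp only [S₃, ← Functor.map_comp, e.comm₂]) (F.homologySequenceδ_naturality T T e n₀ n₁ h)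
  let S₁ : ∀ n₀ n₁ : ℤ, n₀ + 1 = n₁ → ShortComplex (ModuleCat.{v} K) := fun n₀ n₁ h =>
    ShortComplex.mk _ _ (F.homologySequenceδ_comp T hT n₀ n₁ h)
  let ψ₁ : ∀ n₀ n₁ h, S₁ n₀ n₁ h ⟶ S₁ n₀ n₁ h := fun n₀ n₁ h => ShortComplex.homMk ((F.shift n₀).map e.hom₃) ((F.shift n₁).map e.hom₁)
    ((F.shift n₁).map e.hom₂) (F.homologySequenceδ_naturality T T e n₀ n₁ h) (by simp only [S₁, ← Functor.map_comp, e.comm₁])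
  have hf₂ : ∀ n : ℤ, Module.Finite K ((F.shift n).obj T.obj₂) := fun n =>
    haveI := hf₁ n; haveI := hf₃ n; EulerCharShortExact.moduleFinite_X₂_of_exact (F.homologySequence_exact₂ T hT n)
  -- the restricted traces: along `Hⁿ(mor₁)`, along `Hⁿ(mor₂)`, along the connecting map `δ : Hⁿ⁰(T₃) → Hⁿ¹(T₁)`
  set R₁ : ℤ → K := fun n => LinearMap.trace K _ (((ψ₂ n).τ₂.hom).restrict (HopfTrace.mapsTo_range_f (S₂ n) (ψ₂ n)))
  set R₂ : ℤ → K := fun n => LinearMap.trace K _ (((ψ₂ n).τ₃.hom).restrict (HopfTrace.mapsTo_range_g (S₂ n) (ψ₂ n)))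
  set d : ∀ n₀ n₁ : ℤ, n₀ + 1 = n₁ → K := fun n₀ n₁ h =>
    LinearMap.trace K _ (((ψ₃ n₀ n₁ h).τ₃.hom).restrict (HopfTrace.mapsTo_range_g (S₃ n₀ n₁ h) (ψ₃ n₀ n₁ h)))
  have hd_congr : ∀ n₀ n₀' n₁ (h : n₀ + 1 = n₁) (h' : n₀' + 1 = n₁), n₀ = n₀' → d n₀ n₁ h = d n₀' n₁ h' := by
    rintro n₀ _ n₁ h h' rfl; rfl
  have hd0 : ∀ n₀ n₁ (h : n₀ + 1 = n₁), Module.finrank K (T.obj₁.as.homology n₁) = 0 → d n₀ n₁ h = 0 := fun n₀ n₁ h h0 => by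
    haveI := hz T.obj₁ n₁ h0
    exact trace_eq_zero_of_subsingleton _
  -- degreewise splitting (row `TraceHomologySequence`, three times)
  have eA : ∀ n, LinearMap.trace K _ ((F.shift n).map e.hom₂).hom = R₂ n + R₁ n := fun n =>
    haveI := hf₂ n; HopfTrace.trace_τ₂_eq_of_exact (F.homologySequence_exact₂ T hT n) (ψ₂ n)
  have eB : ∀ n : ℤ, LinearMap.trace K _ ((F.shift n).map e.hom₃).hom = d n (n + 1) rfl + R₂ n := fun n =>
    haveI := hf₃ n; HopfTrace.trace_τ₂_eq_of_exact (F.homologySequence_exact₃ T hT n (n + 1) rfl) (ψ₃ n (n + 1) rfl)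
  have eC : ∀ n : ℤ, LinearMap.trace K _ ((F.shift n).map e.hom₁).hom = R₁ n + d (n - 1) n (by omega) := fun n =>
    haveI := hf₁ n; HopfTrace.trace_τ₂_eq_of_exact (F.homologySequence_exact₁ T hT (n - 1) n (by omega)) (ψ₁ (n - 1) n (by omega))
  -- the connecting-map traces cancel in pairs `n ↔ n + 1` (row `HopfTraceFormula`'s pairing lemma on `up ℤ`)
  have pair := HopfTrace.finsum_χ_smul_eq_neg_of_pairing (c := ComplexShape.up ℤ) (fun n => d n (n + 1) rfl)
    (fun n => d (n - 1) n (by omega)) (fun j hj => (hj (by simp)).elim) (fun i hi => (hi (by simp)).elim)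
    (fun i j hij => by
      have hij' : i + 1 = j := hij
      subst hij'
      exact hd_congr _ _ _ _ _ (by omega))
  -- degreewise: `tr Hⁿ(e₁) − tr Hⁿ(e₂) + tr Hⁿ(e₃) = δin + δout`
  have key : ∀ n : ℤ, ((ComplexShape.up ℤ).χ n : ℤ) • LinearMap.trace K _ ((F.shift n).map e.hom₁).hom -
      ((ComplexShape.up ℤ).χ n : ℤ) • LinearMap.trace K _ ((F.shift n).map e.hom₂).hom +
        ((ComplexShape.up ℤ).χ n : ℤ) • LinearMap.trace K _ ((F.shift n).map e.hom₃).hom =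
      ((ComplexShape.up ℤ).χ n : ℤ) • d (n - 1) n (by omega) + ((ComplexShape.up ℤ).χ n : ℤ) • d n (n + 1) rfl := fun n => by
    rw [eA, eB, eC, smul_add, smul_add, smul_add]; abel
  -- finite supports
  have s₁ : (fun n => ((ComplexShape.up ℤ).χ n : ℤ) • LinearMap.trace K _ ((F.shift n).map e.hom₁).hom).HasFiniteSupport := by
    refine h₁.subset fun n hn => ?_
    simp only [GradedObject.finrankSupport, Function.mem_support, ne_eq] at hn ⊢
    exact fun h0 => hn (by haveI := hz T.obj₁ n h0; rw [trace_eq_zero_of_subsingleton, smul_zero])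
  have s₃ : (fun n => ((ComplexShape.up ℤ).χ n : ℤ) • LinearMap.trace K _ ((F.shift n).map e.hom₃).hom).HasFiniteSupport := by
    refine h₃.subset fun n hn => ?_
    simp only [GradedObject.finrankSupport, Function.mem_support, ne_eq] at hn ⊢
    exact fun h0 => hn (by haveI := hz T.obj₃ n h0; rw [trace_eq_zero_of_subsingleton, smul_zero])
  have s₂ : (fun n => ((ComplexShape.up ℤ).χ n : ℤ) • LinearMap.trace K _ ((F.shift n).map e.hom₂).hom).HasFiniteSupport := by
    refine (h₁.union h₃).subset fun n hn => ?_
    by_contra hn'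
    simp only [Set.mem_union, GradedObject.finrankSupport, Function.mem_support, ne_eq, not_or, not_not] at hn hn'
    haveI := hz T.obj₁ n hn'.1
    haveI := hz T.obj₃ n hn'.2
    haveI : Subsingleton ((F.shift n).obj T.obj₂) := subsingleton_X₂_of_exact (S := S₂ n) (F.homologySequence_exact₂ T hT n)
    exact hn (by rw [trace_eq_zero_of_subsingleton, smul_zero])
  have sin : (fun n => ((ComplexShape.up ℤ).χ n : ℤ) • d (n - 1) n (by omega)).HasFiniteSupport := by
    refine h₁.subset fun n hn => ?_
    simp only [GradedObject.finrankSupport, Function.mem_support, ne_eq] at hn ⊢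
    exact fun h0 => hn (by rw [hd0 _ _ _ h0, smul_zero])
  have sout : (fun n => ((ComplexShape.up ℤ).χ n : ℤ) • d n (n + 1) rfl).HasFiniteSupport := by
    refine (h₁.preimage (add_left_injective (1 : ℤ)).injOn).subset fun n hn => ?_
    simp only [GradedObject.finrankSupport, Function.mem_support, ne_eq, Set.mem_preimage] at hn ⊢
    exact fun h0 => hn (by rw [hd0 _ _ _ h0, smul_zero])
  have s₁₂ : (fun n => ((ComplexShape.up ℤ).χ n : ℤ) • LinearMap.trace K _ ((F.shift n).map e.hom₁).hom -
      ((ComplexShape.up ℤ).χ n : ℤ) • LinearMap.trace K _ ((F.shift n).map e.hom₂).hom).HasFiniteSupport := s₁.sub s₂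
  have total : ∑ᶠ n, ((ComplexShape.up ℤ).χ n : ℤ) • LinearMap.trace K _ ((F.shift n).map e.hom₁).hom -
      ∑ᶠ n, ((ComplexShape.up ℤ).χ n : ℤ) • LinearMap.trace K _ ((F.shift n).map e.hom₂).hom +
        ∑ᶠ n, ((ComplexShape.up ℤ).χ n : ℤ) • LinearMap.trace K _ ((F.shift n).map e.hom₃).hom = 0 := by
    rw [← finsum_sub_distrib s₁ s₂, ← finsum_add_distrib s₁₂ s₃, finsum_congr key, finsum_add_distrib sin sout, pair, neg_add_cancel]
  change ∑ᶠ n, ((ComplexShape.up ℤ).χ n : ℤ) • LinearMap.trace K _ ((F.shift n).map e.hom₂).hom =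
    ∑ᶠ n, ((ComplexShape.up ℤ).χ n : ℤ) • LinearMap.trace K _ ((F.shift n).map e.hom₁).hom +
      ∑ᶠ n, ((ComplexShape.up ℤ).χ n : ℤ) • LinearMap.trace K _ ((F.shift n).map e.hom₃).hom
  linear_combination -total

end Literature.Algebra.Homology.Lefschetz
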